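import Literature.NumberTheory.EllipticCurves.BinaryQuarticMeasure
import Mathlib.MeasureTheory.Integral.DominatedConvergence
import Mathlib.Topology.MetricSpace.Ultra.Basic
import HarnessLib

/-!
# Congruence envelopes of a local weight on `V_{ℤ_p}`: the approximation step of the square-free
# sieve (Bhargava–Shankar, proof of Thm 2.21)

`Proofs` companion (theorems only: no definitions, no named facts) of `BinaryQuarticMeasure.lean`
(the probability measure `μ_p` on `V_{ℤ_p} = BinaryQuartic ℤ_[p]`) and
`BinaryQuarticLocalSolubility.lean` (its topology). Source: M. Bhargava, A. Shankar, *Binary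
quartic forms having bounded invariants, and the boundedness of the average rank of elliptic
curves*, Ann. of Math. (2) 181 (2015) 191–242, §2.7 of the published version (= `arXiv:1006.1002v3`),
proof of Thm 2.21 (the square-free sieve), first paragraph:

> "Since `φ_p` is locally constant outside some set of measure zero, there exists an increasing
> sequence of functions `ψ_{p,1} ≤ ψ_{p,2} ≤ ⋯` that are bounded above by and converge pointwise to
> `φ_p`, and a decreasing sequence of functions `1 = ψ'_{p,0} ≥ ψ'_{p,1} ≥ ⋯` that are bounded below
> by and converge pointwise to `φ_p`, such that `ψ_{p,n}` and `ψ'_{p,n}` are defined on `V_{ℤ_p}` by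
> congruence conditions modulo `pⁿ`. … By the dominated convergence theorem, we have
> `lim_n ∫ ψ_{p,n} = lim_n ∫ ψ'_{p,n} = ∫ φ_p`."

This file constructs these sequences explicitly and proves the quoted properties, for any
`φ : V_{ℤ_p} → [0,1]` that is locally constant almost everywhere (as are the weights of the tree's
sieve, `BhargavaShankarSievePhiRegularityProofs`): with the congruence class
`C_n(f) = {g : pⁿ ∣ g_i − f_i for all five coefficients}`,

`ψ_n(f) := inf φ(C_n(f))`, `ψ'_n(f) := sup φ(C_n(f))`

(written out as `sInf (φ '' C_n(f))`, `sSup (φ '' C_n(f))` in every statement, there being no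
definitions in a `Proofs` file).

## Contents

* §1 the classes `C_n(f)`: an equivalence relation (`setOf_congr_eq_of_mem`), decreasing in `n`,
  clopen (`isOpen_setOf_congr`, `isClosed_setOf_congr`: products of closed balls of radius `p⁻ⁿ`,
  open in the ultrametric `ℤ_p`), measurable, and a **neighbourhood basis**
  (`exists_setOf_congr_subset_of_mem_nhds`);
* §2 the envelopes: `ψ_n ≤ φ ≤ ψ'_n`, values in `[0,1]`, **defined modulo `pⁿ`**
  (`sInf_image_congr_eq_of_mem`, `sSup_image_congr_eq_of_mem`), `ψ_n` increasing and `ψ'_n`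
  decreasing in `n` (`monotone_sInf_image_congr`, `antitone_sSup_image_congr`), locally constant
  hence measurable;
* §3 convergence: at every `f` where `φ` is locally constant, `ψ_n(f) = φ(f) = ψ'_n(f)` for large `n`
  (`eventually_sInf_eq_and_sSup_eq`); hence `φ` is a.e. strongly measurable
  (`aestronglyMeasurable_of_ae_eventually_eq`) and, by dominated convergence on the probability
  space `V_{ℤ_p}`, **`∫ ψ_n → ∫ φ` and `∫ ψ'_n → ∫ φ`** (`tendsto_integral_sInf_image_congr`,
  `tendsto_integral_sSup_image_congr`), with `∫ ψ_n ≤ ∫ φ ≤ ∫ ψ'_n` at every level;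
* §4 acceptable weights: `Δ` is constant modulo `pⁿ` on `C_n(f)` (`pow_dvd_disc_sub_disc`), so if
  `φ = 1` off `W_p = {p² ∣ Δ}` then `ψ_n = ψ'_n = 1` off `W_p` for `n ≥ 2`
  (`sInf_eq_one_and_sSup_eq_one_of_not_sq_dvd_disc`) — the remark "`ψ_{p,n}(f) = φ_p(f) = 1`
  unless `p² ∣ Δ(f)`" of the same proof (valid for these envelopes from level `2` on).

## References

* M. Bhargava, A. Shankar, Ann. of Math. (2) 181 (2015) 191–242, §2.7, proof of Thm 2.21
  (published numbering). [cite: BhargavaShankarAnnals2015, §2.7, proof of Thm 2.21 (published numbering)]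
-/

noncomputable section

open scoped Classical Topology
open Filter Set MeasureTheory

namespace Literature.NumberTheory.EllipticCurves

namespace BinaryQuartic

variable (p : ℕ) [Fact p.Prime]

/-! ## §1. Congruence classes `C_n(f) = {g : g ≡ f (mod pⁿ)}` in `V_{ℤ_p}` -/

/-- `f ≡ f (mod pⁿ)`. [folklore] -/
theorem mem_congr_self (n : ℕ) (f : BinaryQuartic ℤ_[p]) :
    f ∈ {g : BinaryQuartic ℤ_[p] | ∀ i, (p : ℤ_[p]) ^ n ∣ g.coeffs i - f.coeffs i} :=
  fun i => by simp

/-- Congruence modulo `pⁿ` is an equivalence relation: congruent forms have the same class.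
[folklore] -/
theorem setOf_congr_eq_of_mem {n : ℕ} {f g : BinaryQuartic ℤ_[p]}
    (hg : ∀ i, (p : ℤ_[p]) ^ n ∣ g.coeffs i - f.coeffs i) :
    {h : BinaryQuartic ℤ_[p] | ∀ i, (p : ℤ_[p]) ^ n ∣ h.coeffs i - g.coeffs i} =
      {h : BinaryQuartic ℤ_[p] | ∀ i, (p : ℤ_[p]) ^ n ∣ h.coeffs i - f.coeffs i} := by
  ext h
  simp only [mem_setOf_eq]
  constructor
  · intro hh i
    have := dvd_add (hh i) (hg i)
    simpa using this
  · intro hh i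
    have := dvd_sub (hh i) (hg i)
    simpa using this

/-- The classes decrease with the level: `C_n(f) ⊆ C_m(f)` for `m ≤ n`. [folklore] -/
theorem setOf_congr_subset {m n : ℕ} (hmn : m ≤ n) (f : BinaryQuartic ℤ_[p]) :
    {g : BinaryQuartic ℤ_[p] | ∀ i, (p : ℤ_[p]) ^ n ∣ g.coeffs i - f.coeffs i} ⊆
      {g : BinaryQuartic ℤ_[p] | ∀ i, (p : ℤ_[p]) ^ m ∣ g.coeffs i - f.coeffs i} :=
  fun _ hg i => (pow_dvd_pow _ hmn).trans (hg i)

/-- `pⁿ ∣ x − a` in `ℤ_p` is `‖x − a‖ ≤ p⁻ⁿ`. [folklore] -/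
theorem pow_dvd_sub_iff_norm_le (n : ℕ) (x a : ℤ_[p]) :
    (p : ℤ_[p]) ^ n ∣ x - a ↔ ‖x - a‖ ≤ (p : ℝ) ^ (-(n : ℤ)) := by
  rw [PadicInt.norm_le_pow_iff_mem_span_pow, Ideal.mem_span_singleton]

/-- The class `C_n(f)` is the preimage under the coefficient map of a product of closed balls of
radius `p⁻ⁿ`. [folklore] -/
theorem setOf_congr_eq_preimage (n : ℕ) (f : BinaryQuartic ℤ_[p]) :
    {g : BinaryQuartic ℤ_[p] | ∀ i, (p : ℤ_[p]) ^ n ∣ g.coeffs i - f.coeffs i} =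
      coeffs ⁻¹' Set.pi univ fun i => Metric.closedBall (f.coeffs i) ((p : ℝ) ^ (-(n : ℤ))) := by
  ext g
  simp only [mem_setOf_eq, mem_preimage, mem_univ_pi, Metric.mem_closedBall, dist_eq_norm,
    pow_dvd_sub_iff_norm_le]

/-- `C_n(f)` is open (closed balls of positive radius are open in the ultrametric `ℤ_p`). [folklore] -/
theorem isOpen_setOf_congr (n : ℕ) (f : BinaryQuartic ℤ_[p]) :
    IsOpen {g : BinaryQuartic ℤ_[p] | ∀ i, (p : ℤ_[p]) ^ n ∣ g.coeffs i - f.coeffs i} := by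
  rw [setOf_congr_eq_preimage]
  refine (isOpen_set_pi finite_univ fun i _ => ?_).preimage continuous_coeffs
  exact IsUltrametricDist.isOpen_closedBall _ (zpow_ne_zero _ (Nat.cast_ne_zero.mpr (Fact.out : p.Prime).ne_zero))

/-- `C_n(f)` is closed. [folklore] -/
theorem isClosed_setOf_congr (n : ℕ) (f : BinaryQuartic ℤ_[p]) :
    IsClosed {g : BinaryQuartic ℤ_[p] | ∀ i, (p : ℤ_[p]) ^ n ∣ g.coeffs i - f.coeffs i} := by
  rw [setOf_congr_eq_preimage]
  exact (isClosed_set_pi fun i _ => Metric.isClosed_closedBall).preimage continuous_coeffs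

/-- `C_n(f)` is measurable. [folklore] -/
theorem measurableSet_setOf_congr (n : ℕ) (f : BinaryQuartic ℤ_[p]) :
    MeasurableSet {g : BinaryQuartic ℤ_[p] | ∀ i, (p : ℤ_[p]) ^ n ∣ g.coeffs i - f.coeffs i} :=
  (isOpen_setOf_congr p n f).measurableSet

/-- **The classes `C_n(f)` form a neighbourhood basis of `f`**: every neighbourhood of `f` in
`V_{ℤ_p}` contains `C_n(f)` for some `n`. [folklore] -/
theorem exists_setOf_congr_subset_of_mem_nhds {f : BinaryQuartic ℤ_[p]} {U : Set (BinaryQuartic ℤ_[p])}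
    (hU : U ∈ 𝓝 f) :
    ∃ n : ℕ, {g : BinaryQuartic ℤ_[p] | ∀ i, (p : ℤ_[p]) ^ n ∣ g.coeffs i - f.coeffs i} ⊆ U := by
  rw [isInducing_coeffs.nhds_eq_comap, mem_comap] at hU
  obtain ⟨V, hV, hVU⟩ := hU
  obtain ⟨ε, hε, hball⟩ := Metric.mem_nhds_iff.mp hV
  obtain ⟨k, hk⟩ := PadicInt.exists_pow_neg_lt p hε
  refine ⟨k, fun g hg => hVU (hball ?_)⟩
  rw [Metric.mem_ball]
  refine lt_of_le_of_lt ((dist_pi_le_iff (zpow_nonneg (Nat.cast_nonneg _) _)).mpr fun i => ?_) hk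
  rw [dist_eq_norm]
  exact (pow_dvd_sub_iff_norm_le p k _ _).mp (hg i)

/-! ## §2. The lower and upper envelopes of level `n` -/

variable {p}

/-- The image `φ(C_n(f))` of a `[0,1]`-valued function is bounded below by `0`. [folklore] -/
theorem bddBelow_image_congr {φ : BinaryQuartic ℤ_[p] → ℝ} (h0 : ∀ f, 0 ≤ φ f) (n : ℕ)
    (f : BinaryQuartic ℤ_[p]) :
    BddBelow (φ '' {g : BinaryQuartic ℤ_[p] | ∀ i, (p : ℤ_[p]) ^ n ∣ g.coeffs i - f.coeffs i}) :=
  ⟨0, by rintro _ ⟨g, -, rfl⟩; exact h0 g⟩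

/-- The image `φ(C_n(f))` of a `[0,1]`-valued function is bounded above by `1`. [folklore] -/
theorem bddAbove_image_congr {φ : BinaryQuartic ℤ_[p] → ℝ} (h1 : ∀ f, φ f ≤ 1) (n : ℕ)
    (f : BinaryQuartic ℤ_[p]) :
    BddAbove (φ '' {g : BinaryQuartic ℤ_[p] | ∀ i, (p : ℤ_[p]) ^ n ∣ g.coeffs i - f.coeffs i}) :=
  ⟨1, by rintro _ ⟨g, -, rfl⟩; exact h1 g⟩

/-- `φ(C_n(f))` is nonempty. [folklore] -/
theorem image_congr_nonempty (φ : BinaryQuartic ℤ_[p] → ℝ) (n : ℕ) (f : BinaryQuartic ℤ_[p]) :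
    (φ '' {g : BinaryQuartic ℤ_[p] | ∀ i, (p : ℤ_[p]) ^ n ∣ g.coeffs i - f.coeffs i}).Nonempty :=
  ⟨φ f, f, mem_congr_self p n f, rfl⟩

/-- **Lower envelope `ψ_n ≤ φ`** (`ψ_n(f) = inf φ(C_n(f))`). [folklore] -/
theorem sInf_image_congr_le {φ : BinaryQuartic ℤ_[p] → ℝ} (h0 : ∀ f, 0 ≤ φ f) (n : ℕ)
    (f : BinaryQuartic ℤ_[p]) :
    sInf (φ '' {g : BinaryQuartic ℤ_[p] | ∀ i, (p : ℤ_[p]) ^ n ∣ g.coeffs i - f.coeffs i}) ≤ φ f :=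
  csInf_le (bddBelow_image_congr h0 n f) ⟨f, mem_congr_self p n f, rfl⟩

/-- **Upper envelope `φ ≤ ψ'_n`** (`ψ'_n(f) = sup φ(C_n(f))`). [folklore] -/
theorem le_sSup_image_congr {φ : BinaryQuartic ℤ_[p] → ℝ} (h1 : ∀ f, φ f ≤ 1) (n : ℕ)
    (f : BinaryQuartic ℤ_[p]) :
    φ f ≤ sSup (φ '' {g : BinaryQuartic ℤ_[p] | ∀ i, (p : ℤ_[p]) ^ n ∣ g.coeffs i - f.coeffs i}) :=
  le_csSup (bddAbove_image_congr h1 n f) ⟨f, mem_congr_self p n f, rfl⟩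

/-- `0 ≤ ψ_n`. [folklore] -/
theorem sInf_image_congr_nonneg {φ : BinaryQuartic ℤ_[p] → ℝ} (h0 : ∀ f, 0 ≤ φ f) (n : ℕ)
    (f : BinaryQuartic ℤ_[p]) :
    0 ≤ sInf (φ '' {g : BinaryQuartic ℤ_[p] | ∀ i, (p : ℤ_[p]) ^ n ∣ g.coeffs i - f.coeffs i}) :=
  le_csInf (image_congr_nonempty φ n f) (by rintro _ ⟨g, -, rfl⟩; exact h0 g)

/-- `ψ_n ≤ 1`. [folklore] -/
theorem sInf_image_congr_le_one {φ : BinaryQuartic ℤ_[p] → ℝ} (h0 : ∀ f, 0 ≤ φ f) (h1 : ∀ f, φ f ≤ 1)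
    (n : ℕ) (f : BinaryQuartic ℤ_[p]) :
    sInf (φ '' {g : BinaryQuartic ℤ_[p] | ∀ i, (p : ℤ_[p]) ^ n ∣ g.coeffs i - f.coeffs i}) ≤ 1 :=
  (sInf_image_congr_le h0 n f).trans (h1 f)

/-- `ψ'_n ≤ 1`. [folklore] -/
theorem sSup_image_congr_le_one {φ : BinaryQuartic ℤ_[p] → ℝ} (h1 : ∀ f, φ f ≤ 1) (n : ℕ)
    (f : BinaryQuartic ℤ_[p]) :
    sSup (φ '' {g : BinaryQuartic ℤ_[p] | ∀ i, (p : ℤ_[p]) ^ n ∣ g.coeffs i - f.coeffs i}) ≤ 1 :=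
  csSup_le (image_congr_nonempty φ n f) (by rintro _ ⟨g, -, rfl⟩; exact h1 g)

/-- `0 ≤ ψ'_n`. [folklore] -/
theorem sSup_image_congr_nonneg {φ : BinaryQuartic ℤ_[p] → ℝ} (h0 : ∀ f, 0 ≤ φ f) (h1 : ∀ f, φ f ≤ 1)
    (n : ℕ) (f : BinaryQuartic ℤ_[p]) :
    0 ≤ sSup (φ '' {g : BinaryQuartic ℤ_[p] | ∀ i, (p : ℤ_[p]) ^ n ∣ g.coeffs i - f.coeffs i}) :=
  (h0 f).trans (le_sSup_image_congr h1 n f)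

/-- **The envelopes are defined modulo `pⁿ`**: congruent forms have the same `ψ_n`. [folklore] -/
theorem sInf_image_congr_eq_of_mem (φ : BinaryQuartic ℤ_[p] → ℝ) {n : ℕ} {f g : BinaryQuartic ℤ_[p]}
    (hg : ∀ i, (p : ℤ_[p]) ^ n ∣ g.coeffs i - f.coeffs i) :
    sInf (φ '' {h : BinaryQuartic ℤ_[p] | ∀ i, (p : ℤ_[p]) ^ n ∣ h.coeffs i - g.coeffs i}) =
      sInf (φ '' {h : BinaryQuartic ℤ_[p] | ∀ i, (p : ℤ_[p]) ^ n ∣ h.coeffs i - f.coeffs i}) := by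
  rw [setOf_congr_eq_of_mem p hg]

/-- Congruent forms have the same `ψ'_n`. [folklore] -/
theorem sSup_image_congr_eq_of_mem (φ : BinaryQuartic ℤ_[p] → ℝ) {n : ℕ} {f g : BinaryQuartic ℤ_[p]}
    (hg : ∀ i, (p : ℤ_[p]) ^ n ∣ g.coeffs i - f.coeffs i) :
    sSup (φ '' {h : BinaryQuartic ℤ_[p] | ∀ i, (p : ℤ_[p]) ^ n ∣ h.coeffs i - g.coeffs i}) =
      sSup (φ '' {h : BinaryQuartic ℤ_[p] | ∀ i, (p : ℤ_[p]) ^ n ∣ h.coeffs i - f.coeffs i}) := by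
  rw [setOf_congr_eq_of_mem p hg]

/-- **`ψ_n` increases with `n`.** [folklore] -/
theorem monotone_sInf_image_congr {φ : BinaryQuartic ℤ_[p] → ℝ} (h0 : ∀ f, 0 ≤ φ f)
    (f : BinaryQuartic ℤ_[p]) :
    Monotone fun n : ℕ =>
      sInf (φ '' {g : BinaryQuartic ℤ_[p] | ∀ i, (p : ℤ_[p]) ^ n ∣ g.coeffs i - f.coeffs i}) :=
  fun _ _ hmn => csInf_le_csInf (bddBelow_image_congr h0 _ f) (image_congr_nonempty φ _ f)
    (image_mono (setOf_congr_subset p hmn f))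

/-- **`ψ'_n` decreases with `n`.** [folklore] -/
theorem antitone_sSup_image_congr {φ : BinaryQuartic ℤ_[p] → ℝ} (h1 : ∀ f, φ f ≤ 1)
    (f : BinaryQuartic ℤ_[p]) :
    Antitone fun n : ℕ =>
      sSup (φ '' {g : BinaryQuartic ℤ_[p] | ∀ i, (p : ℤ_[p]) ^ n ∣ g.coeffs i - f.coeffs i}) :=
  fun _ _ hmn => csSup_le_csSup (bddAbove_image_congr h1 _ f) (image_congr_nonempty φ _ f)
    (image_mono (setOf_congr_subset p hmn f))

/-- **`ψ_n` is locally constant**, hence continuous and measurable. [folklore] -/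
theorem isLocallyConstant_sInf_image_congr (φ : BinaryQuartic ℤ_[p] → ℝ) (n : ℕ) :
    IsLocallyConstant fun f : BinaryQuartic ℤ_[p] =>
      sInf (φ '' {g : BinaryQuartic ℤ_[p] | ∀ i, (p : ℤ_[p]) ^ n ∣ g.coeffs i - f.coeffs i}) := by
  refine (IsLocallyConstant.iff_exists_open _).mpr fun f => ⟨_, isOpen_setOf_congr p n f,
    mem_congr_self p n f, fun g hg => ?_⟩
  exact sInf_image_congr_eq_of_mem φ hg

/-- `ψ'_n` is locally constant. [folklore] -/
theorem isLocallyConstant_sSup_image_congr (φ : BinaryQuartic ℤ_[p] → ℝ) (n : ℕ) :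
    IsLocallyConstant fun f : BinaryQuartic ℤ_[p] =>
      sSup (φ '' {g : BinaryQuartic ℤ_[p] | ∀ i, (p : ℤ_[p]) ^ n ∣ g.coeffs i - f.coeffs i}) := by
  refine (IsLocallyConstant.iff_exists_open _).mpr fun f => ⟨_, isOpen_setOf_congr p n f,
    mem_congr_self p n f, fun g hg => ?_⟩
  exact sSup_image_congr_eq_of_mem φ hg

/-- `ψ_n` is measurable. [folklore] -/
theorem measurable_sInf_image_congr (φ : BinaryQuartic ℤ_[p] → ℝ) (n : ℕ) :
    Measurable fun f : BinaryQuartic ℤ_[p] =>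
      sInf (φ '' {g : BinaryQuartic ℤ_[p] | ∀ i, (p : ℤ_[p]) ^ n ∣ g.coeffs i - f.coeffs i}) :=
  (isLocallyConstant_sInf_image_congr φ n).continuous.measurable

/-- `ψ'_n` is measurable. [folklore] -/
theorem measurable_sSup_image_congr (φ : BinaryQuartic ℤ_[p] → ℝ) (n : ℕ) :
    Measurable fun f : BinaryQuartic ℤ_[p] =>
      sSup (φ '' {g : BinaryQuartic ℤ_[p] | ∀ i, (p : ℤ_[p]) ^ n ∣ g.coeffs i - f.coeffs i}) :=
  (isLocallyConstant_sSup_image_congr φ n).continuous.measurable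

/-! ## §3. Convergence: where `φ` is locally constant the envelopes are eventually equal to `φ` -/

/-- At a point where `φ` is locally constant, `ψ_n(f) = φ(f) = ψ'_n(f)` for all large `n`.
[folklore] -/
theorem eventually_sInf_eq_and_sSup_eq (φ : BinaryQuartic ℤ_[p] → ℝ) {f : BinaryQuartic ℤ_[p]}
    (hf : ∀ᶠ g in 𝓝 f, φ g = φ f) :
    ∀ᶠ n : ℕ in atTop,
      sInf (φ '' {g : BinaryQuartic ℤ_[p] | ∀ i, (p : ℤ_[p]) ^ n ∣ g.coeffs i - f.coeffs i}) = φ f ∧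
      sSup (φ '' {g : BinaryQuartic ℤ_[p] | ∀ i, (p : ℤ_[p]) ^ n ∣ g.coeffs i - f.coeffs i}) = φ f := by
  obtain ⟨n₀, hn₀⟩ := exists_setOf_congr_subset_of_mem_nhds p hf
  refine eventually_atTop.mpr ⟨n₀, fun n hn => ?_⟩
  have himage : φ '' {g : BinaryQuartic ℤ_[p] | ∀ i, (p : ℤ_[p]) ^ n ∣ g.coeffs i - f.coeffs i}
      = {φ f} := by
    refine Subset.antisymm ?_ ?_
    · rintro _ ⟨g, hg, rfl⟩
      exact hn₀ (setOf_congr_subset p hn f hg)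
    · exact singleton_subset_iff.mpr ⟨f, mem_congr_self p n f, rfl⟩
  rw [himage, csInf_singleton, csSup_singleton]
  exact ⟨rfl, rfl⟩

/-- **Pointwise convergence `ψ_n(f) → φ(f)`** where `φ` is locally constant. [folklore] -/
theorem tendsto_sInf_image_congr (φ : BinaryQuartic ℤ_[p] → ℝ) {f : BinaryQuartic ℤ_[p]}
    (hf : ∀ᶠ g in 𝓝 f, φ g = φ f) :
    Tendsto (fun n : ℕ =>
      sInf (φ '' {g : BinaryQuartic ℤ_[p] | ∀ i, (p : ℤ_[p]) ^ n ∣ g.coeffs i - f.coeffs i}))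
      atTop (𝓝 (φ f)) :=
  tendsto_const_nhds.congr' ((eventually_sInf_eq_and_sSup_eq φ hf).mono fun _ h => h.1.symm)

/-- **Pointwise convergence `ψ'_n(f) → φ(f)`** where `φ` is locally constant. [folklore] -/
theorem tendsto_sSup_image_congr (φ : BinaryQuartic ℤ_[p] → ℝ) {f : BinaryQuartic ℤ_[p]}
    (hf : ∀ᶠ g in 𝓝 f, φ g = φ f) :
    Tendsto (fun n : ℕ =>
      sSup (φ '' {g : BinaryQuartic ℤ_[p] | ∀ i, (p : ℤ_[p]) ^ n ∣ g.coeffs i - f.coeffs i}))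
      atTop (𝓝 (φ f)) :=
  tendsto_const_nhds.congr' ((eventually_sInf_eq_and_sSup_eq φ hf).mono fun _ h => h.2.symm)

/-- **An a.e. locally constant function is a.e. strongly measurable** (it is the a.e. limit of
the locally constant `ψ_n`). [folklore] -/
theorem aestronglyMeasurable_of_ae_eventually_eq (φ : BinaryQuartic ℤ_[p] → ℝ)
    (hlc : ∀ᵐ f ∂(volume : Measure (BinaryQuartic ℤ_[p])), ∀ᶠ g in 𝓝 f, φ g = φ f) :
    AEStronglyMeasurable φ (volume : Measure (BinaryQuartic ℤ_[p])) :=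
  aestronglyMeasurable_of_tendsto_ae atTop
    (fun n => (measurable_sInf_image_congr φ n).aestronglyMeasurable)
    (hlc.mono fun _ hf => tendsto_sInf_image_congr φ hf)

/-- **Dominated convergence: `∫ ψ_n → ∫ φ`** for `φ : V_{ℤ_p} → [0,1]` locally constant off a
null set — the first step of the proof of the square-free sieve, Thm 2.21 of Bhargava–Shankar 2015:
"there exists an increasing sequence of functions `ψ_{p,1} ≤ ψ_{p,2} ≤ ⋯` that are bounded above by
and converge pointwise to `φ_p` … defined on `V_{ℤ_p}` by congruence conditions modulo `pⁿ` … By the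
dominated convergence theorem, `lim_n ∫ ψ_{p,n} = ∫ φ_p`", with `ψ_{p,n}(f) = inf φ_p(C_n(f))`.
[cite: BhargavaShankarAnnals2015, §2.7, proof of Thm 2.21 (published numbering)] -/
theorem tendsto_integral_sInf_image_congr {φ : BinaryQuartic ℤ_[p] → ℝ} (h0 : ∀ f, 0 ≤ φ f)
    (h1 : ∀ f, φ f ≤ 1)
    (hlc : ∀ᵐ f ∂(volume : Measure (BinaryQuartic ℤ_[p])), ∀ᶠ g in 𝓝 f, φ g = φ f) :
    Tendsto (fun n : ℕ => ∫ f : BinaryQuartic ℤ_[p],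
        sInf (φ '' {g : BinaryQuartic ℤ_[p] | ∀ i, (p : ℤ_[p]) ^ n ∣ g.coeffs i - f.coeffs i}))
      atTop (𝓝 (∫ f : BinaryQuartic ℤ_[p], φ f)) := by
  refine tendsto_integral_of_dominated_convergence (fun _ => (1 : ℝ))
    (fun n => (measurable_sInf_image_congr φ n).aestronglyMeasurable) (integrable_const 1)
    (fun n => Eventually.of_forall fun f => ?_) (hlc.mono fun f hf => tendsto_sInf_image_congr φ hf)
  rw [Real.norm_eq_abs, abs_le]
  exact ⟨by linarith [sInf_image_congr_nonneg h0 n f], sInf_image_congr_le_one h0 h1 n f⟩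

/-- **Dominated convergence: `∫ ψ'_n → ∫ φ`** ("a decreasing sequence `1 = ψ'_{p,0} ≥ ψ'_{p,1} ≥
⋯` that are bounded below by and converge pointwise to `φ_p`", `ψ'_{p,n}(f) = sup φ_p(C_n(f))`).
[cite: BhargavaShankarAnnals2015, §2.7, proof of Thm 2.21 (published numbering)] -/
theorem tendsto_integral_sSup_image_congr {φ : BinaryQuartic ℤ_[p] → ℝ} (h0 : ∀ f, 0 ≤ φ f)
    (h1 : ∀ f, φ f ≤ 1)
    (hlc : ∀ᵐ f ∂(volume : Measure (BinaryQuartic ℤ_[p])), ∀ᶠ g in 𝓝 f, φ g = φ f) :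
    Tendsto (fun n : ℕ => ∫ f : BinaryQuartic ℤ_[p],
        sSup (φ '' {g : BinaryQuartic ℤ_[p] | ∀ i, (p : ℤ_[p]) ^ n ∣ g.coeffs i - f.coeffs i}))
      atTop (𝓝 (∫ f : BinaryQuartic ℤ_[p], φ f)) := by
  refine tendsto_integral_of_dominated_convergence (fun _ => (1 : ℝ))
    (fun n => (measurable_sSup_image_congr φ n).aestronglyMeasurable) (integrable_const 1)
    (fun n => Eventually.of_forall fun f => ?_) (hlc.mono fun f hf => tendsto_sSup_image_congr φ hf)
  rw [Real.norm_eq_abs, abs_le]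
  exact ⟨by linarith [sSup_image_congr_nonneg h0 h1 n f], sSup_image_congr_le_one h1 n f⟩

/-- `∫ ψ_n ≤ ∫ φ ≤ ∫ ψ'_n` at every level. [folklore] -/
theorem integral_sInf_le_integral_le_integral_sSup {φ : BinaryQuartic ℤ_[p] → ℝ} (h0 : ∀ f, 0 ≤ φ f)
    (h1 : ∀ f, φ f ≤ 1)
    (hlc : ∀ᵐ f ∂(volume : Measure (BinaryQuartic ℤ_[p])), ∀ᶠ g in 𝓝 f, φ g = φ f) (n : ℕ) :
    (∫ f : BinaryQuartic ℤ_[p],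
        sInf (φ '' {g : BinaryQuartic ℤ_[p] | ∀ i, (p : ℤ_[p]) ^ n ∣ g.coeffs i - f.coeffs i}))
        ≤ ∫ f : BinaryQuartic ℤ_[p], φ f ∧
      (∫ f : BinaryQuartic ℤ_[p], φ f) ≤ ∫ f : BinaryQuartic ℤ_[p],
        sSup (φ '' {g : BinaryQuartic ℤ_[p] | ∀ i, (p : ℤ_[p]) ^ n ∣ g.coeffs i - f.coeffs i}) := by
  have hφ : Integrable φ (volume : Measure (BinaryQuartic ℤ_[p])) := by
    refine ⟨aestronglyMeasurable_of_ae_eventually_eq φ hlc, ?_⟩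
    refine HasFiniteIntegral.of_bounded (C := 1) (Eventually.of_forall fun f => ?_)
    rw [Real.norm_eq_abs, abs_le]
    exact ⟨by linarith [h0 f], h1 f⟩
  have hlow : Integrable (fun f : BinaryQuartic ℤ_[p] =>
      sInf (φ '' {g : BinaryQuartic ℤ_[p] | ∀ i, (p : ℤ_[p]) ^ n ∣ g.coeffs i - f.coeffs i})) volume := by
    refine ⟨(measurable_sInf_image_congr φ n).aestronglyMeasurable, ?_⟩
    refine HasFiniteIntegral.of_bounded (C := 1) (Eventually.of_forall fun f => ?_)
    rw [Real.norm_eq_abs, abs_le]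
    exact ⟨by linarith [sInf_image_congr_nonneg h0 n f], sInf_image_congr_le_one h0 h1 n f⟩
  have hup : Integrable (fun f : BinaryQuartic ℤ_[p] =>
      sSup (φ '' {g : BinaryQuartic ℤ_[p] | ∀ i, (p : ℤ_[p]) ^ n ∣ g.coeffs i - f.coeffs i})) volume := by
    refine ⟨(measurable_sSup_image_congr φ n).aestronglyMeasurable, ?_⟩
    refine HasFiniteIntegral.of_bounded (C := 1) (Eventually.of_forall fun f => ?_)
    rw [Real.norm_eq_abs, abs_le]
    exact ⟨by linarith [sSup_image_congr_nonneg h0 h1 n f], sSup_image_congr_le_one h1 n f⟩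
  exact ⟨integral_mono hlow hφ fun f => sInf_image_congr_le h0 n f,
    integral_mono hφ hup fun f => le_sSup_image_congr h1 n f⟩

/-! ## §4. Acceptable weights: the envelopes are `1` off `W_p = {p² ∣ Δ}` at levels `n ≥ 2` -/

/-- Congruent forms modulo `pⁿ` have congruent discriminants: `pⁿ ∣ Δ(g) − Δ(f)`. [folklore] -/
theorem pow_dvd_disc_sub_disc {n : ℕ} {f g : BinaryQuartic ℤ_[p]}
    (hg : ∀ i, (p : ℤ_[p]) ^ n ∣ g.coeffs i - f.coeffs i) :
    (p : ℤ_[p]) ^ n ∣ g.disc - f.disc := by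
  set π := Ideal.Quotient.mk (Ideal.span {(p : ℤ_[p]) ^ n}) with hπ
  have hc : ∀ i, π (g.coeffs i) = π (f.coeffs i) := fun i =>
    (Ideal.Quotient.eq (I := Ideal.span {(p : ℤ_[p]) ^ n})).mpr (Ideal.mem_span_singleton.mpr (hg i))
  have hmap : g.map π = f.map π := by
    ext
    · simpa using hc 0
    · simpa using hc 1
    · simpa using hc 2
    · simpa using hc 3
    · simpa using hc 4
  have h := congrArg BinaryQuartic.disc hmap
  rw [disc_map, disc_map] at h
  exact Ideal.mem_span_singleton.mp ((Ideal.Quotient.eq (I := Ideal.span {(p : ℤ_[p]) ^ n})).mp h)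

/-- Within a class `C_n(f)`, `n ≥ 2`, the condition `p² ∣ Δ` is constant. [folklore] -/
theorem sq_dvd_disc_iff_of_mem {n : ℕ} (hn : 2 ≤ n) {f g : BinaryQuartic ℤ_[p]}
    (hg : ∀ i, (p : ℤ_[p]) ^ n ∣ g.coeffs i - f.coeffs i) :
    (p : ℤ_[p]) ^ 2 ∣ g.disc ↔ (p : ℤ_[p]) ^ 2 ∣ f.disc := by
  have h := (pow_dvd_pow (p : ℤ_[p]) hn).trans (pow_dvd_disc_sub_disc hg)
  constructor
  · intro h1
    have := dvd_sub h1 h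
    simpa using this
  · intro h1
    have := dvd_add h h1
    simpa using this

/-- **Acceptable weights have trivial envelopes off `W_p` at levels `n ≥ 2`.** If `φ(g) = 1`
whenever `p² ∤ Δ(g)` ("acceptable", Bhargava–Shankar 2015, §2.7), then for `n ≥ 2` and `p² ∤ Δ(f)`
both `ψ_n(f) = 1` and `ψ'_n(f) = 1` — the observation "for sufficiently large `p` and `n ≥ 1`, we have
`ψ_{p,n}(f) = φ_p(f) = 1` unless `p² ∣ Δ(f)`" of the proof of Thm 2.21 (for the envelopes
`inf`/`sup` over `C_n(f)` this holds from level `2` on, `Δ` being constant modulo `p²` on `C_n(f)`).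
[cite: BhargavaShankarAnnals2015, §2.7, proof of Thm 2.21 (published numbering)] -/
theorem sInf_eq_one_and_sSup_eq_one_of_not_sq_dvd_disc {φ : BinaryQuartic ℤ_[p] → ℝ}
    (hacc : ∀ g : BinaryQuartic ℤ_[p], ¬ (p : ℤ_[p]) ^ 2 ∣ g.disc → φ g = 1) {n : ℕ} (hn : 2 ≤ n)
    {f : BinaryQuartic ℤ_[p]} (hf : ¬ (p : ℤ_[p]) ^ 2 ∣ f.disc) :
    sInf (φ '' {g : BinaryQuartic ℤ_[p] | ∀ i, (p : ℤ_[p]) ^ n ∣ g.coeffs i - f.coeffs i}) = 1 ∧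
      sSup (φ '' {g : BinaryQuartic ℤ_[p] | ∀ i, (p : ℤ_[p]) ^ n ∣ g.coeffs i - f.coeffs i}) = 1 := by
  have himage : φ '' {g : BinaryQuartic ℤ_[p] | ∀ i, (p : ℤ_[p]) ^ n ∣ g.coeffs i - f.coeffs i}
      = {1} := by
    refine Subset.antisymm ?_ ?_
    · rintro _ ⟨g, hg, rfl⟩
      exact hacc g fun h => hf ((sq_dvd_disc_iff_of_mem hn hg).mp h)
    · refine singleton_subset_iff.mpr ⟨f, mem_congr_self p n f, ?_⟩
      exact hacc f hf
  rw [himage, csInf_singleton, csSup_singleton]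
  exact ⟨rfl, rfl⟩

end BinaryQuartic

end Literature.NumberTheory.EllipticCurves

end
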